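import Mathlib.Logic.Equiv.Fin.Basic
import Mathlib.Data.Fintype.Card
import Mathlib.Data.Fintype.Prod
import Mathlib.Data.Fintype.Option
import Mathlib.Data.Fintype.Sum
import Mathlib.Tactic
import HarnessLib

/-!
# Crux `EquisingularLift`, stub `stub_linearCentre_of_blowupModel`, piece (B'): the coordinate labelling

[OURS · L1 W4.5b] Not a statement of any manuscript. The registered stub `stub_linearCentre_of_blowupModel`
(skeleton v10b of crux `EquisingularLift`, stmt-ResolutionOfSingularities-15660) asks for a closed immersion
`j : H ⟶ ℙ^{r+m}_k` whose LAST `m` homogeneous coordinates (those with index `≥ r + 1`, killed by the graded map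
`fk`) cut out the resolution ideal. The re-embedding by forms
(`Literature.AlgebraicGeometry.Motives.GeneratingSections.formsMap`, file `Motives/FormsEmbedding`) is indexed by
`Fin (n + 1) × (Option (Fin (n + 1)) ⊕ Fin m')` — `(i, inl none) ↔ x_i^{2d}`, `(i, inl (some i')) ↔ x_{i'} x_i^{2d-1}`,
`(i, inr l) ↔ x_i^d V_l` — and accepts any labelling `e : M ≃ Fin (n + 1) × (Option (Fin (n + 1)) ⊕ Fin m')` of the
coordinates. This file supplies the labelling by `Fin (r + m + 1)` putting the `V`-coordinates `(i, inr l)` LAST: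
`r + 1 ≤ c ↔ e c = (i, inr l)` for some `i, l` (pure combinatorics: `finSumFinEquiv`, `Equiv.prodSumDistrib`).
-/

set_option linter.dupNamespace false -- mandated namespace `Summit.<Summit>.<Problem>` of this single-conjunct summit

namespace Summit.ResolutionOfSingularities.ResolutionOfSingularities.Cruxes.EquisingularLift.StrataSplit

/-- **Labelling putting one summand last.** For finite types `A` (non-empty) and `B` there are `r m : ℕ` and a
bijection `e : Fin (r + m + 1) ≃ A ⊕ B` such that the indices `≥ r + 1` are exactly those labelled by `B`
(`r + 1 = |A|`, `m = |B|`; `finSumFinEquiv`). [folklore] -/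
theorem exists_fin_equiv_sum_le_iff {A B : Type} [Fintype A] [Nonempty A] [Fintype B] :
    ∃ (r m : ℕ) (e : Fin (r + m + 1) ≃ A ⊕ B), ∀ c : Fin (r + m + 1), r + 1 ≤ (c : ℕ) ↔ ∃ b, e c = Sum.inr b := by
  obtain ⟨r, hr⟩ : ∃ r, Fintype.card A = r + 1 :=
    ⟨Fintype.card A - 1, (Nat.sub_add_cancel Fintype.card_pos).symm⟩
  set m := Fintype.card B with hm
  let eA : Fin (r + 1) ≃ A := (Fintype.equivFinOfCardEq hr).symm
  let eB : Fin m ≃ B := (Fintype.equivFinOfCardEq rfl).symm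
  have hrm : r + m + 1 = (r + 1) + m := by omega
  let E : Fin (r + m + 1) ≃ A ⊕ B :=
    (finCongr hrm).trans (finSumFinEquiv.symm.trans (Equiv.sumCongr eA eB))
  refine ⟨r, m, E, fun c ↦ ?_⟩
  rcases lt_or_ge (c : ℕ) (r + 1) with hc | hc
  · have h1 : finCongr hrm c = Fin.castAdd m ⟨c, hc⟩ := Fin.ext rfl
    have hE : E c = Sum.inl (eA ⟨c, hc⟩) := by
      simp only [E, Equiv.trans_apply, h1, finSumFinEquiv_symm_apply_castAdd, Equiv.sumCongr_apply,
        Sum.map_inl]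
    constructor
    · intro h; omega
    · rintro ⟨b, hb⟩
      rw [hE] at hb
      exact absurd hb Sum.inl_ne_inr
  · have hc' : (c : ℕ) - (r + 1) < m := by omega
    have h1 : finCongr hrm c = Fin.natAdd (r + 1) ⟨(c : ℕ) - (r + 1), hc'⟩ :=
      Fin.ext (by simp only [finCongr_apply, Fin.val_cast, Fin.natAdd_mk]; omega)
    have hE : E c = Sum.inr (eB ⟨(c : ℕ) - (r + 1), hc'⟩) := by
      simp only [E, Equiv.trans_apply, h1, finSumFinEquiv_symm_apply_natAdd, Equiv.sumCongr_apply,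
        Sum.map_inr]
    exact ⟨fun _ ↦ ⟨_, hE⟩, fun _ ↦ hc⟩

/-- **The coordinate labelling for the re-embedding by forms**: for `n m' : ℕ` there are `r m : ℕ` and
`e : Fin (r + m + 1) ≃ Fin (n + 1) × (Option (Fin (n + 1)) ⊕ Fin m')` such that the coordinates of index
`≥ r + 1` are exactly the `V`-coordinates `(i, inr l)` — so that `GeneratingSections.formsMap … e : H ⟶ ℙ^{r+m}_k`
has the forms `x_i^d V_l` as its last `m` coordinates (`r + 1 = (n + 1)(n + 2)`, `m = (n + 1) m'`). [folklore] -/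
theorem exists_formsIndex_equiv (n m' : ℕ) :
    ∃ (r m : ℕ) (e : Fin (r + m + 1) ≃ Fin (n + 1) × (Option (Fin (n + 1)) ⊕ Fin m')),
      ∀ c : Fin (r + m + 1), r + 1 ≤ (c : ℕ) ↔ ∃ (i : Fin (n + 1)) (l : Fin m'), e c = (i, Sum.inr l) := by
  obtain ⟨r, m, e, he⟩ :=
    exists_fin_equiv_sum_le_iff (A := Fin (n + 1) × Option (Fin (n + 1))) (B := Fin (n + 1) × Fin m')
  refine ⟨r, m, e.trans (Equiv.prodSumDistrib _ _ _).symm, fun c ↦ (he c).trans ⟨?_, ?_⟩⟩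
  · rintro ⟨b, hb⟩
    exact ⟨b.1, b.2, by simp only [Equiv.trans_apply, hb, Equiv.prodSumDistrib_symm_apply_right]⟩
  · rintro ⟨i, l, h⟩
    rw [Equiv.trans_apply] at h
    rcases hec : e c with a | b
    · rw [hec, Equiv.prodSumDistrib_symm_apply_left] at h
      simp only [Prod.mk.injEq] at h
      exact absurd h.2 Sum.inl_ne_inr
    · exact ⟨b, rfl⟩

/-- The complementary reading: the coordinates of index `< r + 1` are the monomial coordinates `(i, inl o)`.
[folklore] -/
theorem formsIndex_lt_iff {n m' r m : ℕ} (e : Fin (r + m + 1) ≃ Fin (n + 1) × (Option (Fin (n + 1)) ⊕ Fin m'))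
    (he : ∀ c : Fin (r + m + 1), r + 1 ≤ (c : ℕ) ↔ ∃ (i : Fin (n + 1)) (l : Fin m'), e c = (i, Sum.inr l))
    (c : Fin (r + m + 1)) :
    (c : ℕ) < r + 1 ↔ ∃ (i : Fin (n + 1)) (o : Option (Fin (n + 1))), e c = (i, Sum.inl o) := by
  rw [← not_le, he c]
  constructor
  · intro h
    rcases hec : e c with ⟨i, o | l⟩
    · exact ⟨i, o, rfl⟩
    · exact absurd ⟨i, l, hec⟩ h
  · rintro ⟨i, o, h⟩ ⟨i', l, h'⟩
    rw [h] at h'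
    simp only [Prod.mk.injEq] at h'
    exact absurd h'.2 Sum.inl_ne_inr

/-- In particular the base coordinate `e.symm (i, inl none)` (the section `x_i^{2d}`) has index `< r + 1`,
i.e. it is NOT killed. [folklore] -/
theorem formsIndex_symm_base_lt {n m' r m : ℕ} (e : Fin (r + m + 1) ≃ Fin (n + 1) × (Option (Fin (n + 1)) ⊕ Fin m'))
    (he : ∀ c : Fin (r + m + 1), r + 1 ≤ (c : ℕ) ↔ ∃ (i : Fin (n + 1)) (l : Fin m'), e c = (i, Sum.inr l))
    (i : Fin (n + 1)) : ((e.symm (i, Sum.inl none)) : ℕ) < r + 1 :=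
  (formsIndex_lt_iff e he _).2 ⟨i, none, e.apply_symm_apply _⟩

end Summit.ResolutionOfSingularities.ResolutionOfSingularities.Cruxes.EquisingularLift.StrataSplit
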